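import Summits.NavierStokesRegularity.FluidComputer.PalasekTowerLiveClassAt
import Literature.Analysis.FluidPDE.BackwardUniquenessSobolevClass
import Literature.Analysis.FluidPDE.TaoClassSymmetry
import Literature.Analysis.FluidPDE.TaoQuantitativeClass
import Literature.Analysis.FluidPDE.TaoLocalisationHolds
import Literature.Analysis.FluidPDE.NSCriticalClosureTao2021
import Literature.Analysis.FluidPDE.ClayDataSpaceShift
import Literature.Analysis.FluidPDE.AxisymmetricReflection
import Literature.Analysis.FluidPDE.ClassicalSolutionRescale
import Literature.Analysis.FluidPDE.IsometryInvariance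

/-!
# A LIVE DATUM STAYS LIVE along every registered stage — stub S3 `LiveDatumPropagatesT` of the robust-mirror
# line, UNCONDITIONALLY, by kernel, from tree theorems (no named fact)

Cell `ns-blowup`, seat `ns-blowup-refuter4` (g11, K224; ledger refuter of record for route `PalasekTowerBreakdown`
rev 19, cruxes stmt-NavierStokesRegularity-20303 `EpisodeBaseT` / -20304 `HeredityAtOneT` / -20305 `HeredityFromTwoT`;
live-class repair `LiveStageAt` / `DeadSlice` of `FluidComputer/PalasekTowerLiveClassAt`; cstrat-19179's line
«robustmirror» v6, stub S3 `LiveDatumPropagatesT`, there taken from the Literature NAMED FACT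
`ns_backward_uniqueness_finiteEnergy` by name). Negative-lane SUPPORT (`--supports 20304`), no Theses import, no
definition, no named fact, nothing about blow-up or regularity is asserted.

This is the sequel of `Theorems/HeredityAtOneT/Negative/DeadSliceBackward.lean` (K221), whose hypothesis (ii)
`HasUniformRapidDecayOn (Icc 0 T) u` (pointwise decay of all space–time derivatives, uniformly in time) is NOT a field
of a registered stage. Rider R7 of K221 asked for backward uniqueness in an `L²`-Sobolev class instead; that theorem is
now in the tree (`IsClassicalNSSolutionOn.backward_unique_of_sobolev`, file `BackwardUniquenessSobolevClass`, after
Temam 1977 Ch. III §6 Lemma 6.2), and the tree's Tao chain puts every registered stage in that class: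

* a registered stage of an UNFORCED design (`S.f = 0`) is a classical solution of the free system on the closed slab
  `[0, τ_k] × ℝ³` with `sup_t ‖u(t)‖_{L²} < ∞` (`Stage.classical`, `Stage.energy`) and rapidly decaying datum
  (`Stage.initial`, `Schedule.datum_decay`);
* hence `u ∈ L^∞_t H^k_x` for all `k` (`tao2011_hasBoundedSobolevNormsOn_holds`, Tao 2013 Cor. 11.1), i.e. `(u, p)` is an
  `H^k`-classical solution (`IsHkClassicalSolutionOn`), hence the velocity of a Tao-class solution
  (`IsHkClassicalSolutionOn.exists_isTaoSolutionOn`: `u, ∂ₜu ∈ L^∞_t H^k_x`);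
* Tao's class is covariant under linear isometries (`IsTaoSolutionOn.conj_linearIsometryEquiv`), and two Tao-class
  solutions of the free system that agree at the FINAL time agree on `[0, T]` (`backward_unique_of_sobolev`); so a linear
  isometry fixing the final slice fixes the datum (`conj_eq_on_Icc_of_conj_eq_final`, the backward twin of the tree's
  `IsTaoSolutionOn.conj_eq_of_datum`);
* a dead final slice (axisymmetric AND swirl-free in a rigid placement `(A, b)`) is fixed, after the placement, by every
  rotation about the axis and by the meridian reflection (`isAxisymmetric_iff_conj_rotZLIE`, `IsAxisymmetric.conj_reflY_eq`);
  the placed flow `t ↦ conjSlice A b (u t)` is again a finite-energy classical free flow with rapidly decaying datum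
  (`isClassicalNSSolutionOn_conjSlice`, `lintegral_conjSlice`, `hasRapidSpatialDecay_conjSlice`); so the datum is fixed by
  the same maps, i.e. dead (`IsAxisymmetric.hasNoSwirl_of_conj_reflY_eq`).

Main theorems: `deadSlice_initial_of_deadSlice_final_one` (viscosity `1`, the stages' viscosity; finite energy + rapidly
decaying datum; NO pointwise decay in time, NO velocity bound) and its registered-stage form `liveStageAt_of_not_deadSlice`
— for EVERY rate table `R`, every design `S` with `S.f = 0`, every level `k` and every registered stage `s`,
`¬ DeadSlice S.u₀ → LiveStageAt R S s` — which is the body of stub S3 `LiveDatumPropagatesT` (there `R = TowerRates.tuned`)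
with its `∀` spelled out; the stub closes by `fun S hf k s h => liveStageAt_of_not_deadSlice S hf s h`.
-/

noncomputable section

namespace Summit.NavierStokesRegularity.HeredityAtOneTDeadSliceBackwardStage

open MeasureTheory Set Function
open scoped ENNReal NNReal
open Literature.Analysis.FluidPDE
open Summit.NavierStokesRegularity.FluidComputer.PalasekTowerClayBridge

/-! ## Backward rigidity in Tao's class (any viscosity) -/

/-- **A linear isometry fixing the FINAL slice of a Tao-class free flow fixes every slice**: the conjugate flow
`(t, x) ↦ R (u t (R⁻¹ x))` is Tao-class (`IsTaoSolutionOn.conj_linearIsometryEquiv`) and agrees with `u` at `t = T`,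
so the two agree on `[0, T]` by backward uniqueness in the Sobolev class
(`IsClassicalNSSolutionOn.backward_unique_of_sobolev`). The backward twin of `IsTaoSolutionOn.conj_eq_of_datum`.
[cite: Temam1997, Ch. III §6.2 with Lemma 6.2 (pp. 172–175)] -/
theorem conj_eq_on_Icc_of_conj_eq_final {T ν : ℝ} (hT : 0 < T) (hν : 0 < ν)
    (R : EuclideanSpace ℝ (Fin 3) ≃ₗᵢ[ℝ] EuclideanSpace ℝ (Fin 3))
    {u₀ : EuclideanSpace ℝ (Fin 3) → EuclideanSpace ℝ (Fin 3)}
    {u : ℝ → EuclideanSpace ℝ (Fin 3) → EuclideanSpace ℝ (Fin 3)} {p : ℝ → EuclideanSpace ℝ (Fin 3) → ℝ}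
    (h : IsTaoSolutionOn T ν u₀ u p) (hfix : ∀ x, R (u T (R.symm x)) = u T x) :
    ∀ t ∈ Icc 0 T, ∀ x, R (u t (R.symm x)) = u t x := by
  have hc := h.conj_linearIsometryEquiv R hT
  have hfin : (fun t x => R (u t (R.symm x))) T = u T := funext hfix
  intro t ht x
  exact congrFun (IsClassicalNSSolutionOn.backward_unique_of_sobolev hT hν hc.classical h.classical hc.sobolev
    hc.sobolev_dt h.sobolev h.sobolev_dt hfin t ht) x

/-- **A dead final slice of a Tao-class free flow placed at the identity comes from a dead datum**: if `u T` is
axisymmetric and swirl-free, so is `u₀` (rotations about the axis and the meridian reflection fix `u T`, hence `u₀`).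
[cite: Temam1997, Ch. III §6.2 with Lemma 6.2 (pp. 172–175)] -/
theorem isAxisymmetric_hasNoSwirl_initial_of_final {T ν : ℝ} (hT : 0 < T) (hν : 0 < ν)
    {u₀ : EuclideanSpace ℝ (Fin 3) → EuclideanSpace ℝ (Fin 3)}
    {u : ℝ → EuclideanSpace ℝ (Fin 3) → EuclideanSpace ℝ (Fin 3)} {p : ℝ → EuclideanSpace ℝ (Fin 3) → ℝ}
    (h : IsTaoSolutionOn T ν u₀ u p) (hax : IsAxisymmetric (u T)) (hsw : HasNoSwirl (u T)) :
    IsAxisymmetric u₀ ∧ HasNoSwirl u₀ := by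
  have h00 : (0 : ℝ) ∈ Icc 0 T := ⟨le_rfl, hT.le⟩
  have hrot : ∀ θ x, rotZLIE θ (u₀ ((rotZLIE θ).symm x)) = u₀ x := fun θ x => by
    rw [← h.initial]
    exact conj_eq_on_Icc_of_conj_eq_final hT hν (rotZLIE θ) h ((isAxisymmetric_iff_conj_rotZLIE (u T)).1 hax θ) 0 h00 x
  have hax0 : IsAxisymmetric u₀ := (isAxisymmetric_iff_conj_rotZLIE u₀).2 hrot
  have hrefl : ∀ x, reflY (u₀ (reflY.symm x)) = u₀ x := fun x => by
    rw [← h.initial]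
    exact conj_eq_on_Icc_of_conj_eq_final hT hν reflY h (fun y => hax.conj_reflY_eq hsw y) 0 h00 x
  exact ⟨hax0, hax0.hasNoSwirl_of_conj_reflY_eq hrefl⟩

/-! ## Rigid placements of finite-energy classical free flows with decaying datum -/

/-- The placed flow `t ↦ conjSlice A b (u t) = A⁻¹ (u t (A · + b))` of a classical free flow is a classical free flow
(`spaceTranslate` by `b`, then `conj_linearIsometryEquiv` by `A⁻¹`). [folklore] -/
theorem isClassicalNSSolutionOn_conjSlice {T ν : ℝ} (hT : 0 < T)
    (A : EuclideanSpace ℝ (Fin 3) ≃ₗᵢ[ℝ] EuclideanSpace ℝ (Fin 3)) (b : EuclideanSpace ℝ (Fin 3))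
    {u : ℝ → EuclideanSpace ℝ (Fin 3) → EuclideanSpace ℝ (Fin 3)} {p : ℝ → EuclideanSpace ℝ (Fin 3) → ℝ}
    (hu : IsClassicalNSSolutionOn (Icc 0 T) ν 0 u p) :
    IsClassicalNSSolutionOn (Icc 0 T) ν 0 (fun t => conjSlice A b (u t)) (fun t x => p t (b + A x)) := by
  have hS : UniqueDiffOn ℝ (Icc 0 T) := uniqueDiffOn_Icc hT
  have h1 : IsClassicalNSSolutionOn (Icc 0 T) ν 0 (fun t x => u t (b + x)) (fun t x => p t (b + x)) :=
    (hu.spaceTranslate b).congr_force fun s _ y => by simp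
  have h2 := (h1.conj_linearIsometryEquiv A.symm hS).congr_force (g := 0) fun s _ y => by simp
  have he : (fun t x => A.symm ((fun t x => u t (b + x)) t (A.symm.symm x))) = fun t => conjSlice A b (u t) := by
    funext t x; simp [conjSlice, add_comm]
  have hp : (fun t x => (fun t x => p t (b + x)) t (A.symm.symm x)) = fun t x => p t (b + A x) := by
    funext t x; simp
  rw [he, hp] at h2
  exact h2

/-- The placed slice has the same `L²` mass: `∫ ‖A⁻¹ (v (A x + b))‖² dx = ∫ ‖v‖²` (`A⁻¹` is an isometry; `x ↦ A x + b`
preserves Lebesgue measure). [folklore] -/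
theorem lintegral_conjSlice (A : EuclideanSpace ℝ (Fin 3) ≃ₗᵢ[ℝ] EuclideanSpace ℝ (Fin 3)) (b : EuclideanSpace ℝ (Fin 3))
    (v : EuclideanSpace ℝ (Fin 3) → EuclideanSpace ℝ (Fin 3)) :
    ∫⁻ x, ‖conjSlice A b v x‖ₑ ^ 2 = ∫⁻ x, ‖v x‖ₑ ^ 2 := by
  have hn : ∀ y, ‖A.symm y‖ₑ = ‖y‖ₑ := fun y => by
    rw [← ofReal_norm, ← ofReal_norm, A.symm.norm_map]
  simp only [conjSlice, hn]
  rw [lintegral_comp_linearIsometryEquiv A (fun y => ‖v (y + b)‖ₑ ^ 2)]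
  exact lintegral_add_right_eq_self (fun y => ‖v y‖ₑ ^ 2) b

/-- Rapid decay of all derivatives is invariant under rigid placements: `conjSlice A b u₀` decays rapidly if `u₀`
does (`HasRapidSpatialDecay.spaceShift` for the translation; derivatives and weights are invariant under the linear
isometries `A`, `A⁻¹`). [folklore] -/
theorem hasRapidSpatialDecay_conjSlice (A : EuclideanSpace ℝ (Fin 3) ≃ₗᵢ[ℝ] EuclideanSpace ℝ (Fin 3))
    (b : EuclideanSpace ℝ (Fin 3)) {u₀ : EuclideanSpace ℝ (Fin 3) → EuclideanSpace ℝ (Fin 3)}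
    (h : HasRapidSpatialDecay u₀) : HasRapidSpatialDecay (conjSlice A b u₀) := by
  have h1 : HasRapidSpatialDecay (fun x => u₀ (b + x)) := h.spaceShift b
  have he : conjSlice A b u₀ = ⇑A.symm ∘ ((fun x => u₀ (b + x)) ∘ ⇑A) := by
    funext x; simp [conjSlice, add_comm]
  intro n K
  obtain ⟨C, hC⟩ := h1 n K
  refine ⟨C, fun x => ?_⟩
  rw [he, LinearIsometryEquiv.norm_iteratedFDeriv_comp_left, LinearIsometryEquiv.norm_iteratedFDeriv_comp_right,
    ← A.norm_map x]
  exact hC (A x)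

/-- A finite-energy classical free flow (viscosity `1`) on the closed slab with rapidly decaying datum is the velocity
of a Tao-class solution: `u ∈ L^∞_t H^k_x` by Tao 2013 Cor. 11.1 (`tao2011_hasBoundedSobolevNormsOn_holds`), so
`(u, p)` is `H^k`-classical, and `IsHkClassicalSolutionOn.exists_isTaoSolutionOn` supplies a Tao-class pressure.
[cite: Tao2011, Cor. 11.1 + Thm. 5.4 (iv)] -/
theorem exists_isTaoSolutionOn_of_finiteEnergy_decay {T : ℝ} (hT : 0 < T)
    {u : ℝ → EuclideanSpace ℝ (Fin 3) → EuclideanSpace ℝ (Fin 3)} {p : ℝ → EuclideanSpace ℝ (Fin 3) → ℝ}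
    (hu : IsClassicalNSSolutionOn (Icc 0 T) 1 0 u p)
    (hE : ∃ C : ℝ≥0∞, C < ⊤ ∧ ∀ t ∈ Icc 0 T, ∫⁻ x, ‖u t x‖ₑ ^ 2 ≤ C) (h₀ : HasRapidSpatialDecay (u 0)) :
    ∃ q : ℝ → EuclideanSpace ℝ (Fin 3) → ℝ, IsTaoSolutionOn T 1 (u 0) u q := by
  obtain ⟨C, hCtop, hC⟩ := hE
  have hE' : ∃ C : ℝ≥0, ∀ t ∈ Icc 0 T, ∫⁻ x, ‖u t x‖ₑ ^ 2 ≤ C :=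
    ⟨C.toNNReal, fun t ht => by rw [ENNReal.coe_toNNReal hCtop.ne]; exact hC t ht⟩
  have hB : HasBoundedSobolevNormsOn (Icc 0 T) u := tao2011_hasBoundedSobolevNormsOn_holds one_pos hT hu hE' h₀
  have hk : IsHkClassicalSolutionOn (Icc 0 T) u p := by
    refine ⟨hu, fun n => ?_⟩
    obtain ⟨Cn, hCn⟩ := hB n
    refine ⟨max 1 Cn, fun s hs => ?_⟩
    calc eLpNorm (iteratedFDeriv ℝ n (u s)) 2 volume
        ≤ max 1 (Cn : ℝ≥0∞) := eLpNorm_two_le_max_of_lintegral_sq_le (hCn s hs)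
      _ = ((max 1 Cn : ℝ≥0) : ℝ≥0∞) := by rw [ENNReal.coe_max, ENNReal.coe_one]
  exact hk.exists_isTaoSolutionOn hT

/-! ## Dead slices propagate backward; a live datum stays live -/

/-- **A dead final slice comes from a dead datum** (viscosity `1`): if a finite-energy classical free flow on
`[0, T] × ℝ³` with rapidly decaying datum is, at time `T`, axisymmetric AND swirl-free in some rigid placement, then so
is its datum, in the same placement. Compared with `HeredityAtOneTDeadSliceBackward.deadSlice_initial_of_deadSlice_final`
the pointwise space–time decay hypothesis `HasUniformRapidDecayOn` is replaced by the two fields every registered stage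
carries (finite energy, decaying datum). [cite: Temam1997, Ch. III §6.2 with Lemma 6.2 (pp. 172–175)] -/
theorem deadSlice_initial_of_deadSlice_final_one {T : ℝ} (hT : 0 < T)
    {u : ℝ → EuclideanSpace ℝ (Fin 3) → EuclideanSpace ℝ (Fin 3)} {p : ℝ → EuclideanSpace ℝ (Fin 3) → ℝ}
    (hu : IsClassicalNSSolutionOn (Icc 0 T) 1 0 u p)
    (hE : ∃ C : ℝ≥0∞, C < ⊤ ∧ ∀ t ∈ Icc 0 T, ∫⁻ x, ‖u t x‖ₑ ^ 2 ≤ C) (h₀ : HasRapidSpatialDecay (u 0))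
    (hdead : DeadSlice (u T)) : DeadSlice (u 0) := by
  obtain ⟨A, b, hax, hsw⟩ := hdead
  -- the placed flow is again a finite-energy classical free flow with decaying datum, hence Tao-class
  have hv : IsClassicalNSSolutionOn (Icc 0 T) 1 0 (fun t => conjSlice A b (u t)) (fun t x => p t (b + A x)) :=
    isClassicalNSSolutionOn_conjSlice hT A b hu
  have hvE : ∃ C : ℝ≥0∞, C < ⊤ ∧ ∀ t ∈ Icc 0 T, ∫⁻ x, ‖conjSlice A b (u t) x‖ₑ ^ 2 ≤ C := by
    obtain ⟨C, hCtop, hC⟩ := hE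
    exact ⟨C, hCtop, fun t ht => by rw [lintegral_conjSlice]; exact hC t ht⟩
  have hv₀ : HasRapidSpatialDecay ((fun t => conjSlice A b (u t)) 0) := hasRapidSpatialDecay_conjSlice A b h₀
  obtain ⟨q, hq⟩ := exists_isTaoSolutionOn_of_finiteEnergy_decay hT hv hvE hv₀
  obtain ⟨hax0, hsw0⟩ := isAxisymmetric_hasNoSwirl_initial_of_final hT one_pos hq hax hsw
  exact ⟨A, b, hax0, hsw0⟩

/-- **A live datum stays live** (viscosity `1`): if the datum of a finite-energy classical free flow on `[0, T] × ℝ³`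
with rapidly decaying datum is not a dead slice, then neither is its slice at time `T`.
[cite: Temam1997, Ch. III §6.2 with Lemma 6.2 (pp. 172–175)] -/
theorem not_deadSlice_final_of_not_deadSlice_initial_one {T : ℝ} (hT : 0 < T)
    {u : ℝ → EuclideanSpace ℝ (Fin 3) → EuclideanSpace ℝ (Fin 3)} {p : ℝ → EuclideanSpace ℝ (Fin 3) → ℝ}
    (hu : IsClassicalNSSolutionOn (Icc 0 T) 1 0 u p)
    (hE : ∃ C : ℝ≥0∞, C < ⊤ ∧ ∀ t ∈ Icc 0 T, ∫⁻ x, ‖u t x‖ₑ ^ 2 ≤ C) (h₀ : HasRapidSpatialDecay (u 0))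
    (hlive : ¬ DeadSlice (u 0)) : ¬ DeadSlice (u T) :=
  fun h => hlive (deadSlice_initial_of_deadSlice_final_one hT hu hE h₀ h)

/-- **Stub S3 `LiveDatumPropagatesT`, unconditionally, for every rate table**: a registered stage (unit viscosity,
margins `routeG`) of an UNFORCED design whose datum is not a dead slice is live — its readout slice at `τ_k` is not dead.
The stage supplies exactly the hypotheses of `not_deadSlice_final_of_not_deadSlice_initial_one`: `Stage.classical` with
`S.f = 0`, `Stage.energy`, and `Stage.initial` with `Schedule.datum_decay`. [cite: Temam1997, Ch. III §6.2 with Lemma 6.2 (pp. 172–175)] -/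
theorem liveStageAt_of_not_deadSlice {R : TowerRates} (S : Schedule R) (hf : S.f = 0) {k : ℕ}
    (s : Stage 1 R S (Margins.routeG R) k) (hlive : ¬ DeadSlice S.u₀) : LiveStageAt R S s := by
  have hcl : IsClassicalNSSolutionOn (Icc 0 (S.τ k)) 1 0 s.u s.p := by
    have h := s.classical
    rwa [hf] at h
  have h₀ : HasRapidSpatialDecay (s.u 0) := by
    rw [s.initial]; exact S.datum_decay
  have hlive' : ¬ DeadSlice (s.u 0) := by
    rw [s.initial]; exact hlive
  exact not_deadSlice_final_of_not_deadSlice_initial_one (S.τ_pos k) hcl s.energy h₀ hlive'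

/-- The `∀`-form consumed verbatim by the robust-mirror line (its `def LiveDatumPropagatesT` at `R = TowerRates.tuned`):
for every unforced design on ANY rate table, every level and every registered stage, a live datum gives a live stage.
[cite: Temam1997, Ch. III §6.2 with Lemma 6.2 (pp. 172–175)] -/
theorem liveDatumPropagates (R : TowerRates) :
    ∀ S : Schedule R, S.f = 0 → ∀ (k : ℕ) (s : Stage 1 R S (Margins.routeG R) k),
      ¬ DeadSlice S.u₀ → LiveStageAt R S s :=
  fun S hf _ s h => liveStageAt_of_not_deadSlice S hf s h

end Summit.NavierStokesRegularity.HeredityAtOneTDeadSliceBackwardStage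

end
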